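import Summits.QuantumFields.YangMills.Theorems.BalabanUVNodesN15CurvedLaplacianSpecies
import Summits.QuantumFields.YangMills.Theorems.BalabanUVNodesN15BackgroundPairSpaceMatrix
import HarnessLib

/-!
# Route «BalabanUVNodes» (cluster K4 «SpineRates»), Track-A DAG node N15 = NE2, BACKGROUND LAYER — BAŁABAN's DRESSED PAIR (3.63)–(3.65) AROUND A CURVED BASE
# POINT `U`: the propagator at the perturbed background `U′U` as the Neumann-dressed pair of `G(U)` with the BACKGROUND's covariant derivatives as derived pieces;
# the resolvent certificate (it inverts `Δ_{SR} + P` when `G` inverts `Δ_R + P`) and the background-Lipschitz increment at a curved base point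

Cell `pub-ymgap`, seat `pub-ymgap-dag-n15-w3` (WIDTH SEAT 3∕3 on node N15, director-ym №197 ∕ HUMAN RULING D-0149; plan g77 `W-SEAT-START-LIST.md` §n15 item 3
«`NE2PlusOperator` for the background layer at curved U» — second piece).  `bears_on: R4∕N15 · K3⁷ SpineGivenEndpointR13SepCoPH (stmt-QuantumFields-20544)`.
Filed `--kind proof --supports stmt-QuantumFields-20544 --as helper` — COUNT-NEUTRAL.  Imports BY NAME this seat's file 1 `…N15CurvedLaplacianSpecies` (p583814:
`gaugePair`, `covSpeciesOpM`, `curvCoefA`, `curvCoefC`, ★★ `covLapM_gaugePair_mul_eq`, the row letters; through it dag-n15-c FILE 28 `covLapM`, n15-b part 18 `covD`) and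
dag-n15-c M1 `…N15BackgroundPairSpaceMatrix` (`unstackM`, `unstackM_apply`, `bgPairM`, `projO_none_bgPairM`, `hasMaj_unstackM`; through it n15-b B2 `stack`, `projO`,
`projO_none_comp_stack`, `hasMaj_stack`, B1a `bgPropV_fix`, `isUnit_stepV`, `hasMaj_bgPropV`, `hasMaj_V_bgPropV`, lit `B11SectG.hasMaj_comp_exp`); nothing in the tree is
modified.

WHY.  [Balaban1985BackgroundPropagators] (3.63)–(3.65) pp. 402–403 (tree `B9.lean` NeumannRep: *«the operator G′ can be represented as G′ = G′₀(I − R′)^{−1} =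
G′₀Σ_{n=0}^∞R′^n»*) dress the propagator at a (3.35)-regular background `U` into the propagator at the perturbed background `U′U` by the Neumann series in
`V′(A)G(U)`, the perturbation `V′₁(A)` of (3.52) being first order in the BACKGROUND's covariant derivatives `D^η_U`.  The lineage's generic Neumann device (n15-b B1a
`bgPropV`, B2 `stack`∕`projO`, dag-n15-c M1 `bgPairM`∕`unstackM`) is stated for ARBITRARY derived pieces `D_j`, but has so far been inhabited only with the FLAT pieces
`∇^±_μ G` (the `U ≡ 1` base point; n15-c FILE 28 `unstackM_comp_stack_eq_speciesOpM_comp`, INTENT-31 `…BackgroundDressedInverse`).  File 1 supplied (3.53) around a CURVED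
orthogonal background `R` in transporter form, `Δ_{SR} = Δ_R − V_R(c, a)` with `V_R = covSpeciesOpM`.  THIS FILE inhabits the device AT THE CURVED BASE POINT:

* §1 `covPieces η τ Rp G` (def): the background's COVARIANT derived pieces `D⁺_{R,μ}G = covD η R⁺_μ τ_μ ∘ G`, `D⁻_{R,μ}G = −covD η R⁻_μ τ_μ⁻¹ ∘ G` over `J ⊕ J`
  (`covPieces_one`: at `Rp ≡ 1` they are FILE 18∕24's `fgrad ∘ G`, `bgrad ∘ G`); ★ `unstackM_comp_stack_covPieces`: `V̂(C, A) ∘ stack G (covPieces) = V_R(C, A) ∘ G` — the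
  bridge to M1 (curved twin of FILE 28's `unstackM_comp_stack_eq_speciesOpM_comp`); `curvDressed η τ R S G := bgPairM G (covPieces η τ (gaugePair τ R) G) (curvCoefC …)
  (curvCoefA …)` (def) — THE DRESSED PAIR `X̂(U′U) = (1 − Ĝ(U)V̂)⁻¹Ĝ(U)`, `Ĝ(U) = (G, D⁺_{R,μ}G, D⁻_{R,μ}G)`;
* §2 THE RESOLVENT CERTIFICATE: ★★ `sub_covSpecies_comp_dressed_eq_id` — for ANY left inverse `Δ` of `G` and any coefficients, `(Δ − V_R(C, A)) ∘ pr₀X̂ = id` under the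
  Neumann unit hypothesis (the dressed pair's `pr₀`-component solves (3.65) `X = G + G∘V_R∘X` with the CURVED species, `projO_covDressed_fix`); `dressed_comp_sub_covSpecies_eq_id`
  (the other side, finite dimension via `Matrix.mul_eq_one_comm`); ★★★ `curvDressed_inverts`: if `G` inverts `covLapM τ η (gaugePair τ R) + P` on the left (`P` = ANY
  `U′`-independent remainder, e.g. the gauge-fixing and averaging terms `DRD*`, `aQ*Q` of `Δ_a` (3.26)) then `pr₀ ∘ curvDressed` inverts `covLapM τ η (gaugePair τ (S·R)) + P`
  ON BOTH SIDES — what the Neumann device dresses at a curved base point IS the Green's function at the perturbed curved background (file 1's (3.53)-curved);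
* §3 LETTERS: `curvRowLetter` (one row letter `r_V = |ι|p + |ι|³p + |ι||J|(|ι|p² + q)` for all coefficients, file 1 §4), `hasMaj_unstackM_curvCoef` (`V̂ ≤ diagK(r_V(1 + |J ⊕ J|))`),
  `isUnit_curvDressed` (the Neumann unit from the smallness `β·r_V(1 + |J ⊕ J|)·c_r < 1` — (3.63)'s `O(1)B₀α₁ < 1`), ★★ `hasMaj_curvDressed` (`X̂ ≤ β(1 − q)⁻¹e^{−ρd}`), ★★
  `hasMaj_curvDressed_sub` — THE BACKGROUND-LIPSCHITZ INCREMENT AT A CURVED BASE POINT: `pr₀X̂ − G = G∘(V̂∘X̂) ≤ β·R_V·β(1 − q)⁻¹·c_r·e^{−ρd}`, LINEAR in the transporter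
  letters of `S` — the ingredient «`X^η(U′U) − X^η(U)` is background-Lipschitz AT FIXED η» of `T4EtaRate`'s header item (5) (NE2-LIP), typed directly from the (3.42)₀,₁-shaped
  block majorants of `G = G(U)` and of its covariant pieces AT the curved `U` (HYPOTHESES of the shape of `B9.Thm31Printed`∕`Thm33Printed`, displayed, not asserted).

HONEST FRAMING ∕ LIMITS.  Neumann-device bookkeeping + finite-dimensional linear algebra at a curved base point over hypothesis-SHAPED letters ([B9] (3.26) p. 394,
(3.35)–(3.37) p. 396, (3.42) p. 397, (3.50)–(3.53) p. 400, (3.63)–(3.65) pp. 402–403 are SHAPES ∕ MECHANISM only; nothing of [B9] asserted); the `U`-layer letters and the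
Neumann smallness are DISPLAYED; `P` is free; crude constants.  NE2⁺ NOT PRINTED, NOT proved; N15 NOT discharged; counts of record UNMOVED (typed 28∕28 · discharged 5∕27); one
finite 𝕋⁴ at fixed ε — NOT infinite volume, NOT OS on ℝ⁴, NOT a mass gap, NOT Clay; R4 closes the conditional finite-𝕋⁴ rung `BalabanLadder.UV` only.  Restate-immune.
-/

set_option autoImplicit false

noncomputable section
open scoped BigOperators Matrix
open Finset

namespace Summit.QuantumFields.YangMills.BalabanUVNodes.N15.CurvedSpecies

open Literature.MathematicalPhysics.QuantumFieldTheory.Balaban1983to89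
open Literature.MathematicalPhysics.QuantumFieldTheory.Balaban1983to89.B11SectG (BlockNorm HasMaj RowSum hasMaj_comp_exp)
open Literature.MathematicalPhysics.QuantumFieldTheory.Balaban1983to89.T4EtaRateCoeffDefect (diagK diagK_nonneg)
open Literature.MathematicalPhysics.QuantumFieldTheory.Balaban1983to89.B6RandomWalk (Triangle254)
open Summit.QuantumFields.YangMills.BalabanUVNodes.N15.DerivDefect (fdiffN)
open Summit.QuantumFields.YangMills.BalabanUVNodes.N15.MatrixSpecies (mmulOp mmulOp_apply liftMap liftEquiv liftBlk covD covD_apply)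
open Summit.QuantumFields.YangMills.BalabanUVNodes.N15.BackgroundLayer (fgrad bgrad speciesOpM covLapM covD_one fdiffN_liftMap_eq_fgrad fdiffN_liftMap_symm_eq_neg_bgrad
  stack projO blkPair stack_apply_none stack_apply_some projO_none_comp_stack hasMaj_stack unstackM unstackM_apply bgPairM projO_none_bgPairM hasMaj_unstackM
  bgPropV bgPropV_fix isUnit_stepV hasMaj_bgPropV hasMaj_V_bgPropV)
open Summit.QuantumFields.YangMills.BalabanUVNodes.N15.BackgroundModel (kappa_ofBlocks)

variable {X ι J : Type} [Fintype X] [DecidableEq X] [Fintype ι] [DecidableEq ι] [Fintype J] [DecidableEq J]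

/-! ## §1 The covariant derived pieces, the bridge to M1's pair, the dressed pair around a curved base point -/

section Pieces

variable (η : ℝ) (τ : J → X ≃ X)

/-- THE BACKGROUND's COVARIANT DERIVED PIECES of a propagator `G` over the doubled direction set: `inl μ ↦ D⁺_{R,μ}G = covD η R⁺_μ τ_μ ∘ G`, `inr μ ↦ D⁻_{R,μ}G =
−covD η R⁻_μ τ_μ⁻¹ ∘ G` (the lineage's backward sign) — the stacked unknown of (3.64) is `(X, D^±_U X)` at a CURVED `U`. [cite: Balaban1985BackgroundPropagators, (3.52) p.400, (3.64) p.403 (shape)] -/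
def covPieces (Rp : J ⊕ J → X → Matrix ι ι ℝ) (G : (X × ι → ℝ) →ₗ[ℝ] (X × ι → ℝ)) : J ⊕ J → (X × ι → ℝ) →ₗ[ℝ] (X × ι → ℝ) :=
  Sum.elim (fun μ => covD η (Rp (Sum.inl μ)) (τ μ) ∘ₗ G) (fun μ => -(covD η (Rp (Sum.inr μ)) (τ μ).symm ∘ₗ G))

omit [Fintype X] [DecidableEq X] [Fintype J] [DecidableEq J] in
/-- Unfolding (forward). [folklore] -/
@[simp] theorem covPieces_inl (Rp : J ⊕ J → X → Matrix ι ι ℝ) (G : (X × ι → ℝ) →ₗ[ℝ] (X × ι → ℝ)) (μ : J) :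
    covPieces η τ Rp G (Sum.inl μ) = covD η (Rp (Sum.inl μ)) (τ μ) ∘ₗ G := rfl

omit [Fintype X] [DecidableEq X] [Fintype J] [DecidableEq J] in
/-- Unfolding (backward). [folklore] -/
@[simp] theorem covPieces_inr (Rp : J ⊕ J → X → Matrix ι ι ℝ) (G : (X × ι → ℝ) →ₗ[ℝ] (X × ι → ℝ)) (μ : J) :
    covPieces η τ Rp G (Sum.inr μ) = -(covD η (Rp (Sum.inr μ)) (τ μ).symm ∘ₗ G) := rfl

omit [Fintype X] [DecidableEq X] [Fintype J] [DecidableEq J] in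
/-- DICTIONARY (flat base point): at `Rp ≡ 1` the covariant pieces are the plain quotients after `G` — FILE 18∕24's `hDf`∕`hDb` shape `fgrad η⁻¹ e_μ ∘ G`, `bgrad η⁻¹ e_μ ∘ G`.
[folklore] -/
theorem covPieces_one (G : (X × ι → ℝ) →ₗ[ℝ] (X × ι → ℝ)) :
    covPieces η τ (fun _ _ => 1) G = Sum.elim (fun μ => fgrad η⁻¹ (liftEquiv (τ μ) ι) ∘ₗ G) (fun μ => bgrad η⁻¹ (liftEquiv (τ μ) ι) ∘ₗ G) := by
  funext j
  cases j with
  | inl μ =>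
      rw [covPieces_inl, Sum.elim_inl, show (fun _ : X => (1 : Matrix ι ι ℝ)) = fun _ => 1 from rfl, covD_one, fdiffN_liftMap_eq_fgrad]
  | inr μ =>
      rw [covPieces_inr, Sum.elim_inr, show (fun _ : X => (1 : Matrix ι ι ℝ)) = fun _ => 1 from rfl, covD_one, fdiffN_liftMap_symm_eq_neg_bgrad,
        LinearMap.neg_comp, neg_neg]

omit [Fintype X] [DecidableEq X] [DecidableEq J] in
/-- ★ **THE BRIDGE TO M1's PAIR AT A CURVED BASE POINT**: the unstacked matrix perturbation after the stack of `G` with its COVARIANT derived pieces IS the curved species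
operator after `G`, `V̂(C, A) ∘ (G, D⁺_{R}G, D⁻_{R}G) = V_R(C, A) ∘ G`. [cite: Balaban1985BackgroundPropagators, (3.63)–(3.64) pp.402–403 (`V′(A)G(U)`: shape)] -/
theorem unstackM_comp_stack_covPieces (Rp : J ⊕ J → X → Matrix ι ι ℝ) (G : (X × ι → ℝ) →ₗ[ℝ] (X × ι → ℝ)) (C : X → Matrix ι ι ℝ)
    (A : J ⊕ J → X → Matrix ι ι ℝ) :
    unstackM C A ∘ₗ stack G (covPieces η τ Rp G) = covSpeciesOpM η τ Rp C A ∘ₗ G := by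
  refine LinearMap.ext fun f => funext fun p => ?_
  rw [LinearMap.comp_apply, LinearMap.comp_apply, unstackM_apply, covSpeciesOpM, LinearMap.add_apply, Pi.add_apply, mmulOp_apply, LinearMap.coe_sum,
    Finset.sum_apply, Finset.sum_apply, Fintype.sum_sum_type, ← Finset.sum_add_distrib]
  refine congrArg₂ (· + ·) (Finset.sum_congr rfl fun j _ => rfl) (Finset.sum_congr rfl fun μ _ => ?_)
  rw [LinearMap.sub_apply, Pi.sub_apply, LinearMap.comp_apply, LinearMap.comp_apply, mmulOp_apply, mmulOp_apply, sub_eq_add_neg, ← Finset.sum_neg_distrib]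
  refine congrArg₂ (· + ·) (Finset.sum_congr rfl fun j _ => rfl) (Finset.sum_congr rfl fun j _ => ?_)
  rw [stack_apply_some, covPieces_inr, LinearMap.neg_apply, LinearMap.comp_apply, Pi.neg_apply, mul_neg]

variable (R S : J → X → Matrix ι ι ℝ)

/-- **THE DRESSED PAIR AROUND A CURVED BASE POINT** `X̂(U′U) = (1 − Ĝ(U)V̂)⁻¹Ĝ(U)`: M1's `bgPairM` of a propagator `G` (= `G(U)`), its COVARIANT derived pieces at the background
transport `gaugePair τ R` and file 1's exact curved coefficients of the perturbation `S`; component `none` = the dressed propagator, component `some (inl∕inr μ)` = its covariant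
derivatives. [cite: Balaban1985BackgroundPropagators, (3.63)–(3.65) pp.402–403 (shape, mechanism)] -/
def curvDressed (G : (X × ι → ℝ) →ₗ[ℝ] (X × ι → ℝ)) : (X × ι → ℝ) →ₗ[ℝ] ((X × ι) × Option (J ⊕ J) → ℝ) :=
  bgPairM G (covPieces η τ (gaugePair τ R) G) (curvCoefC η τ R S) (curvCoefA η τ R S)

end Pieces

/-! ## §2 The resolvent certificate: the dressed pair inverts the perturbed operator -/

section Resolvent

variable (η : ℝ) (τ : J → X ≃ X) (Rp : J ⊕ J → X → Matrix ι ι ℝ) (G : (X × ι → ℝ) →ₗ[ℝ] (X × ι → ℝ)) (C : X → Matrix ι ι ℝ) (A : J ⊕ J → X → Matrix ι ι ℝ)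

/-- (3.65) WITH THE CURVED SPECIES: under the Neumann unit hypothesis the `pr₀`-component of the dressed pair solves `X = G + G∘(V_R(C, A)∘X)` and the unstacked perturbation
reads `V̂∘X̂ = V_R(C, A)∘X`. [cite: Balaban1985BackgroundPropagators, (3.65) p.403 (shape)] -/
theorem projO_covDressed_fix (hunit : IsUnit (1 - LinearMap.toMatrix' (stack G (covPieces η τ Rp G) ∘ₗ unstackM C A))) :
    unstackM C A ∘ₗ bgPairM G (covPieces η τ Rp G) C A = covSpeciesOpM η τ Rp C A ∘ₗ (projO none ∘ₗ bgPairM G (covPieces η τ Rp G) C A) ∧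
      projO none ∘ₗ bgPairM G (covPieces η τ Rp G) C A =
        G + G ∘ₗ (covSpeciesOpM η τ Rp C A ∘ₗ (projO none ∘ₗ bgPairM G (covPieces η τ Rp G) C A)) := by
  set D := covPieces η τ Rp G with hD
  set V := unstackM C A with hV
  have hfix : bgPairM G D C A = stack G D + (stack G D ∘ₗ V) ∘ₗ bgPairM G D C A := bgPropV_fix hunit
  have hW : bgPairM G D C A = stack G D ∘ₗ (LinearMap.id + V ∘ₗ bgPairM G D C A) := by
    rw [LinearMap.comp_add, LinearMap.comp_id, ← LinearMap.comp_assoc]; exact hfix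
  have hX : projO none ∘ₗ bgPairM G D C A = G ∘ₗ (LinearMap.id + V ∘ₗ bgPairM G D C A) := by
    conv_lhs => rw [hW]
    rw [← LinearMap.comp_assoc, projO_none_comp_stack]
  have hVX : V ∘ₗ bgPairM G D C A = covSpeciesOpM η τ Rp C A ∘ₗ (projO none ∘ₗ bgPairM G D C A) := by
    conv_lhs => rw [hW]
    rw [← LinearMap.comp_assoc, hV, hD, unstackM_comp_stack_covPieces, LinearMap.comp_assoc, ← hD, ← hV, ← hX]
  refine ⟨hVX, ?_⟩
  rw [← hVX]
  exact projO_none_bgPairM hunit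

/-- ★★ **LEFT INVERSE**: for ANY left inverse `Δ` of `G` (`Δ ∘ G = id`) and any coefficients, `(Δ − V_R(C, A)) ∘ pr₀X̂ = id` under the Neumann unit hypothesis — the dressed
propagator is a right inverse of the perturbed operator. [cite: Balaban1985BackgroundPropagators, (3.63)–(3.65) pp.402–403 (mechanism)] -/
theorem sub_covSpecies_comp_dressed_eq_id {Δ : (X × ι → ℝ) →ₗ[ℝ] (X × ι → ℝ)} (hΔ : Δ ∘ₗ G = LinearMap.id)
    (hunit : IsUnit (1 - LinearMap.toMatrix' (stack G (covPieces η τ Rp G) ∘ₗ unstackM C A))) :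
    (Δ - covSpeciesOpM η τ Rp C A) ∘ₗ (projO none ∘ₗ bgPairM G (covPieces η τ Rp G) C A) = LinearMap.id := by
  obtain ⟨-, hX⟩ := projO_covDressed_fix η τ Rp G C A hunit
  set Xop := projO none ∘ₗ bgPairM G (covPieces η τ Rp G) C A with hXop
  have h1 : Δ ∘ₗ Xop = LinearMap.id + covSpeciesOpM η τ Rp C A ∘ₗ Xop := by
    conv_lhs => rw [hX]
    rw [LinearMap.comp_add, ← LinearMap.comp_assoc, hΔ, LinearMap.id_comp]
  rw [LinearMap.sub_comp, h1]
  exact add_sub_cancel_right _ _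

/-- … and a RIGHT INVERSE (finite dimension: `AB = 1 ⟹ BA = 1` for the square matrices `LinearMap.toMatrix'`). [folklore] -/
theorem dressed_comp_sub_covSpecies_eq_id {Δ : (X × ι → ℝ) →ₗ[ℝ] (X × ι → ℝ)} (hΔ : Δ ∘ₗ G = LinearMap.id)
    (hunit : IsUnit (1 - LinearMap.toMatrix' (stack G (covPieces η τ Rp G) ∘ₗ unstackM C A))) :
    (projO none ∘ₗ bgPairM G (covPieces η τ Rp G) C A) ∘ₗ (Δ - covSpeciesOpM η τ Rp C A) = LinearMap.id := by
  have h := sub_covSpecies_comp_dressed_eq_id η τ Rp G C A hΔ hunit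
  have hm : LinearMap.toMatrix' (Δ - covSpeciesOpM η τ Rp C A) * LinearMap.toMatrix' (projO none ∘ₗ bgPairM G (covPieces η τ Rp G) C A) = 1 := by
    rw [← LinearMap.toMatrix'_comp, h, LinearMap.toMatrix'_id]
  have hm' := mul_eq_one_comm.mp hm
  apply LinearMap.toMatrix'.injective
  rw [LinearMap.toMatrix'_comp, hm', LinearMap.toMatrix'_id]

variable (R S : J → X → Matrix ι ι ℝ)

/-- ★★★ **THE RESOLVENT CERTIFICATE AT A CURVED BASE POINT.**  Let `R` be an orthogonal forward transporter field (`R_μ(x)R_μ(x)ᵀ = 1`), `S` a perturbation transporter field,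
`P` ANY operator (the `U′`-independent remainder) and `G` a left inverse of `covLapM τ η (gaugePair τ R) + P` (the propagator AT the curved background).  Under the Neumann
unit hypothesis the `pr₀`-component of the dressed pair inverts `covLapM τ η (gaugePair τ (S·R)) + P` ON BOTH SIDES: what the Neumann device (3.63)–(3.65) dresses IS the Green's
function at the perturbed curved background (file 1's (3.53)-curved `Δ_{SR} = Δ_R − V_R`). [cite: Balaban1985BackgroundPropagators, (3.53) p.400, (3.63)–(3.65) pp.402–403 (mechanism)] -/
theorem curvDressed_inverts (hR : ∀ μ x, R μ x * (R μ x)ᵀ = 1) {P : (X × ι → ℝ) →ₗ[ℝ] (X × ι → ℝ)}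
    (hG : (covLapM τ η (gaugePair τ R) + P) ∘ₗ G = LinearMap.id)
    (hunit : IsUnit (1 - LinearMap.toMatrix' (stack G (covPieces η τ (gaugePair τ R) G) ∘ₗ unstackM (curvCoefC η τ R S) (curvCoefA η τ R S)))) :
    (covLapM τ η (gaugePair τ (fun μ x => S μ x * R μ x)) + P) ∘ₗ (projO none ∘ₗ curvDressed η τ R S G) = LinearMap.id ∧
      (projO none ∘ₗ curvDressed η τ R S G) ∘ₗ (covLapM τ η (gaugePair τ (fun μ x => S μ x * R μ x)) + P) = LinearMap.id := by
  have h353 : covLapM τ η (gaugePair τ (fun μ x => S μ x * R μ x)) + P =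
      (covLapM τ η (gaugePair τ R) + P) - covSpeciesOpM η τ (gaugePair τ R) (curvCoefC η τ R S) (curvCoefA η τ R S) := by
    rw [covLapM_gaugePair_mul_eq η τ R S hR]; abel
  rw [h353]
  exact ⟨sub_covSpecies_comp_dressed_eq_id η τ _ G _ _ hG hunit, dressed_comp_sub_covSpecies_eq_id η τ _ G _ _ hG hunit⟩

end Resolvent

/-! ## §3 Letters: the Neumann unit, the dressed pair's majorant, the background-Lipschitz increment at a curved base point -/

section Letters

variable (ι J) in
/-- ONE ROW LETTER FOR ALL CURVED COEFFICIENTS: `r_V(p, q) = |ι|p + |ι|³p + |ι||J|(|ι|p² + q)` (file 1 §4: rows of `a⁺`, `a⁻`, `c` are each `≤ r_V`). [folklore] -/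
def curvRowLetter (p q : ℝ) : ℝ :=
  (Fintype.card ι : ℝ) * p + (Fintype.card ι : ℝ) ^ 3 * p + (Fintype.card ι : ℝ) * ((Fintype.card J : ℝ) * ((Fintype.card ι : ℝ) * p ^ 2 + q))

omit [Fintype X] [DecidableEq X] [DecidableEq ι] [DecidableEq J] in
/-- The row letter is nonnegative for nonnegative transporter letters. [folklore] -/
theorem curvRowLetter_nonneg {p q : ℝ} (hp : 0 ≤ p) (hq : 0 ≤ q) : 0 ≤ curvRowLetter ι J p q := by
  unfold curvRowLetter; positivity

variable (η : ℝ) (τ : J → X ≃ X) (R S : J → X → Matrix ι ι ℝ) {g : B6.Geometry} (blk : X → g.Site)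

omit [DecidableEq X] [DecidableEq J] in
/-- THE UNSTACKED CURVED PERTURBATION IS DIAGONALLY MAJORISED: `V̂(c, a) ≤ diagK (r_V(1 + |J ⊕ J|))` from file 1's row letters (orthogonal `S`, `R`; transporter letters
`|S − 1| ≤ ηp`, `|S_μ − R₋ᵀS₋R₋| ≤ η²q` entrywise; `η > 0`). [cite: Balaban1985BackgroundPropagators, (3.37) p.396, (3.63) p.402 (shapes)] -/
theorem hasMaj_unstackM_curvCoef {p q : ℝ} (hη : 0 < η) (hp : 0 ≤ p) (hq : 0 ≤ q) (hS : ∀ μ x, S μ x * (S μ x)ᵀ = 1)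
    (hR : ∀ μ x, (R μ x)ᵀ * R μ x = 1) (hR' : ∀ μ x, R μ x * (R μ x)ᵀ = 1) (hSp : ∀ μ x i j, |(S μ x - 1) i j| ≤ η * p)
    (hSq : ∀ μ x i j, |covShiftDefect τ R S μ x i j| ≤ η ^ 2 * q) :
    HasMaj (BlockNorm.ofBlocks g (blkPair (liftBlk blk ι))) (BlockNorm.ofBlocks g (liftBlk blk ι)) (unstackM (curvCoefC η τ R S) (curvCoefA η τ R S))
      (diagK fun _ => curvRowLetter ι J p q * (1 + Fintype.card (J ⊕ J))) := by
  have hι : 0 ≤ (Fintype.card ι : ℝ) := Nat.cast_nonneg _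
  have e0 : 0 ≤ (Fintype.card ι : ℝ) * p := mul_nonneg hι hp
  have e1 : 0 ≤ (Fintype.card ι : ℝ) ^ 3 * p := mul_nonneg (pow_nonneg hι 3) hp
  have e2 : 0 ≤ (Fintype.card ι : ℝ) * ((Fintype.card J : ℝ) * ((Fintype.card ι : ℝ) * p ^ 2 + q)) := by positivity
  have h1 : (Fintype.card ι : ℝ) * p ≤ curvRowLetter ι J p q := by unfold curvRowLetter; linarith
  have h2 : (Fintype.card ι : ℝ) ^ 3 * p ≤ curvRowLetter ι J p q := by unfold curvRowLetter; linarith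
  have h3 : (Fintype.card ι : ℝ) * ((Fintype.card J : ℝ) * ((Fintype.card ι : ℝ) * p ^ 2 + q)) ≤ curvRowLetter ι J p q := by
    unfold curvRowLetter; linarith
  have hR1 : ∀ μ x i j, |R μ x i j| ≤ 1 := fun μ x i j => abs_entry_le_one_of_orthogonal (hR' μ x) i j
  refine hasMaj_unstackM blk (curvRowLetter_nonneg (ι := ι) (J := J) hp hq) (fun x i => (rowSum_curvCoefC_le τ R S hη hS hR hSp hSq x i).trans h3) fun j x i => ?_
  cases j with
  | inl μ => exact (rowSum_curvCoefA_inl_le τ R S hη hSp μ x i).trans h1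
  | inr μ => exact (rowSum_curvCoefA_inr_le τ R S hη hR1 hSp μ x i).trans h2

variable (G : (X × ι → ℝ) →ₗ[ℝ] (X × ι → ℝ)) {β δ σ cr : ℝ}

omit [DecidableEq X] [DecidableEq J] in
/-- THE STACK of `G` and its covariant pieces inherits their common block majorant (B2 `hasMaj_stack`). [folklore] -/
theorem hasMaj_stack_covPieces (hβ : 0 ≤ β)
    (hG : HasMaj (BlockNorm.ofBlocks g (liftBlk blk ι)) (BlockNorm.ofBlocks g (liftBlk blk ι)) G (fun y y' => β * Real.exp (-(δ * g.dist y y'))))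
    (hD : ∀ j, HasMaj (BlockNorm.ofBlocks g (liftBlk blk ι)) (BlockNorm.ofBlocks g (liftBlk blk ι)) (covPieces η τ (gaugePair τ R) G j)
      (fun y y' => β * Real.exp (-(δ * g.dist y y')))) :
    HasMaj (BlockNorm.ofBlocks g (liftBlk blk ι)) (BlockNorm.ofBlocks g (blkPair (liftBlk blk ι))) (stack G (covPieces η τ (gaugePair τ R) G))
      (fun y y' => β * Real.exp (-(δ * g.dist y y'))) :=
  hasMaj_stack (g := g) (liftBlk blk ι) (fun _ _ => mul_nonneg hβ (Real.exp_nonneg _)) hG hD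

/-- THE NEUMANN UNIT at a curved base point from the smallness `β·r_V(1 + |J ⊕ J|)·c_r < 1` ((3.63)'s `O(1)B₀α₁ < 1`), the (3.42)₀,₁-shaped block majorants `β·e^{−δd}` of
`G = G(U)` and of its covariant pieces AT `U`, a [B6] carrier with row sums `c_r` at rate `σ ≤ δ`, and file 1's transporter letters. [cite: Balaban1985BackgroundPropagators, (3.63)–(3.64) pp.402–403 (mechanism)] -/
theorem isUnit_curvDressed {p q : ℝ} (hd : ∀ a b : g.Site, 0 ≤ g.dist a b) (hrow : RowSum g σ cr) (hσδ : σ ≤ δ) (hβ : 0 ≤ β) (hη : 0 < η) (hp : 0 ≤ p)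
    (hq : 0 ≤ q) (hS : ∀ μ x, S μ x * (S μ x)ᵀ = 1) (hR : ∀ μ x, (R μ x)ᵀ * R μ x = 1) (hR' : ∀ μ x, R μ x * (R μ x)ᵀ = 1)
    (hSp : ∀ μ x i j, |(S μ x - 1) i j| ≤ η * p) (hSq : ∀ μ x i j, |covShiftDefect τ R S μ x i j| ≤ η ^ 2 * q)
    (hG : HasMaj (BlockNorm.ofBlocks g (liftBlk blk ι)) (BlockNorm.ofBlocks g (liftBlk blk ι)) G (fun y y' => β * Real.exp (-(δ * g.dist y y'))))
    (hD : ∀ j, HasMaj (BlockNorm.ofBlocks g (liftBlk blk ι)) (BlockNorm.ofBlocks g (liftBlk blk ι)) (covPieces η τ (gaugePair τ R) G j)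
      (fun y y' => β * Real.exp (-(δ * g.dist y y'))))
    (hsmall : β * (curvRowLetter ι J p q * (1 + Fintype.card (J ⊕ J))) * cr < 1) :
    IsUnit (1 - LinearMap.toMatrix' (stack G (covPieces η τ (gaugePair τ R) G) ∘ₗ unstackM (curvCoefC η τ R S) (curvCoefA η τ R S))) :=
  isUnit_stepV (liftBlk blk ι) (blkPair (liftBlk blk ι)) hd hrow hσδ hβ
    (mul_nonneg (curvRowLetter_nonneg (ι := ι) (J := J) hp hq) (by positivity)) (hasMaj_stack_covPieces η τ R blk G hβ hG hD)
    (hasMaj_unstackM_curvCoef η τ R S blk hη hp hq hS hR hR' hSp hSq) hsmall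

/-- ★★ **THE DRESSED PAIR's MAJORANT** (Neumann with decay): `X̂ ≤ β(1 − β·R_V·c_r)⁻¹·e^{−ρd}`, `R_V = r_V(1 + |J ⊕ J|)`, for `0 ≤ ρ`, `ρ + σ ≤ δ`.
[cite: Balaban1985BackgroundPropagators, (3.64) p.403 (mechanism); Balaban1984PropagatorsII, (2.52)–(2.56) pp.232–233] -/
theorem hasMaj_curvDressed {p q ρ : ℝ} (htri : Triangle254 g) (hd : ∀ a b : g.Site, 0 ≤ g.dist a b) (hrow : RowSum g σ cr) (hσ : 0 ≤ σ) (hρ : 0 ≤ ρ)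
    (hρδ : ρ + σ ≤ δ) (hβ : 0 ≤ β) (hη : 0 < η) (hp : 0 ≤ p) (hq : 0 ≤ q) (hS : ∀ μ x, S μ x * (S μ x)ᵀ = 1) (hR : ∀ μ x, (R μ x)ᵀ * R μ x = 1)
    (hR' : ∀ μ x, R μ x * (R μ x)ᵀ = 1) (hSp : ∀ μ x i j, |(S μ x - 1) i j| ≤ η * p) (hSq : ∀ μ x i j, |covShiftDefect τ R S μ x i j| ≤ η ^ 2 * q)
    (hG : HasMaj (BlockNorm.ofBlocks g (liftBlk blk ι)) (BlockNorm.ofBlocks g (liftBlk blk ι)) G (fun y y' => β * Real.exp (-(δ * g.dist y y'))))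
    (hD : ∀ j, HasMaj (BlockNorm.ofBlocks g (liftBlk blk ι)) (BlockNorm.ofBlocks g (liftBlk blk ι)) (covPieces η τ (gaugePair τ R) G j)
      (fun y y' => β * Real.exp (-(δ * g.dist y y'))))
    (hsmall : β * (curvRowLetter ι J p q * (1 + Fintype.card (J ⊕ J))) * cr < 1) :
    HasMaj (BlockNorm.ofBlocks g (liftBlk blk ι)) (BlockNorm.ofBlocks g (blkPair (liftBlk blk ι))) (curvDressed η τ R S G)
      (fun y y' => β * (1 - β * (curvRowLetter ι J p q * (1 + Fintype.card (J ⊕ J))) * cr)⁻¹ * Real.exp (-(ρ * g.dist y y'))) :=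
  hasMaj_bgPropV (liftBlk blk ι) (blkPair (liftBlk blk ι)) htri hd hrow hσ hρ hρδ hβ
    (mul_nonneg (curvRowLetter_nonneg (ι := ι) (J := J) hp hq) (by positivity)) (hasMaj_stack_covPieces η τ R blk G hβ hG hD)
    (hasMaj_unstackM_curvCoef η τ R S blk hη hp hq hS hR hR' hSp hSq) hsmall

/-- ★★ **THE BACKGROUND-LIPSCHITZ INCREMENT AT A CURVED BASE POINT.**  Under the same letters the dressed propagator differs from `G = G(U)` by
`pr₀X̂ − G = G∘(V̂∘X̂) ≤ β·R_V·β(1 − β·R_V·c_r)⁻¹·c_r·e^{−ρd}`, `R_V = r_V(1 + |J ⊕ J|)` LINEAR in the transporter letters of `S` — the ingredient «`X^η(U′U) − X^η(U)` is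
background-Lipschitz AT FIXED η» of the spine (`T4EtaRate` header item (5), NE2-LIP), typed directly at a CURVED `U` from the (3.42)₀,₁-shaped letters of `G(U)` and of its
covariant pieces (displayed, not asserted). [cite: Balaban1985BackgroundPropagators, (3.63)–(3.65) pp.402–403 (mechanism), Thm 3.4 p.400 (the analyticity it underlies)] -/
theorem hasMaj_curvDressed_sub {p q ρ : ℝ} (htri : Triangle254 g) (hd : ∀ a b : g.Site, 0 ≤ g.dist a b) (hrow : RowSum g σ cr) (hσ : 0 ≤ σ) (hρ : 0 ≤ ρ)
    (hρδ : ρ + σ ≤ δ) (hβ : 0 ≤ β) (hη : 0 < η) (hp : 0 ≤ p) (hq : 0 ≤ q) (hS : ∀ μ x, S μ x * (S μ x)ᵀ = 1) (hR : ∀ μ x, (R μ x)ᵀ * R μ x = 1)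
    (hR' : ∀ μ x, R μ x * (R μ x)ᵀ = 1) (hSp : ∀ μ x i j, |(S μ x - 1) i j| ≤ η * p) (hSq : ∀ μ x i j, |covShiftDefect τ R S μ x i j| ≤ η ^ 2 * q)
    (hG : HasMaj (BlockNorm.ofBlocks g (liftBlk blk ι)) (BlockNorm.ofBlocks g (liftBlk blk ι)) G (fun y y' => β * Real.exp (-(δ * g.dist y y'))))
    (hD : ∀ j, HasMaj (BlockNorm.ofBlocks g (liftBlk blk ι)) (BlockNorm.ofBlocks g (liftBlk blk ι)) (covPieces η τ (gaugePair τ R) G j)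
      (fun y y' => β * Real.exp (-(δ * g.dist y y'))))
    (hsmall : β * (curvRowLetter ι J p q * (1 + Fintype.card (J ⊕ J))) * cr < 1) :
    HasMaj (BlockNorm.ofBlocks g (liftBlk blk ι)) (BlockNorm.ofBlocks g (liftBlk blk ι)) (projO none ∘ₗ curvDressed η τ R S G - G)
      (fun y y' => β * ((curvRowLetter ι J p q * (1 + Fintype.card (J ⊕ J))) * (β * (1 - β * (curvRowLetter ι J p q * (1 + Fintype.card (J ⊕ J))) * cr)⁻¹)) * cr *
        Real.exp (-(ρ * g.dist y y'))) := by
  have hRV : 0 ≤ curvRowLetter ι J p q * (1 + Fintype.card (J ⊕ J)) := mul_nonneg (curvRowLetter_nonneg (ι := ι) (J := J) hp hq) (by positivity)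
  have hGs := hasMaj_stack_covPieces η τ R blk G hβ hG hD
  have hV := hasMaj_unstackM_curvCoef η τ R S blk hη hp hq hS hR hR' hSp hSq
  have hunit := isUnit_curvDressed η τ R S blk G hd hrow (by linarith) hβ hη hp hq hS hR hR' hSp hSq hG hD hsmall
  have hfix : projO none ∘ₗ curvDressed η τ R S G =
      G + G ∘ₗ (unstackM (curvCoefC η τ R S) (curvCoefA η τ R S) ∘ₗ curvDressed η τ R S G) := projO_none_bgPairM hunit
  rw [hfix, add_sub_cancel_left]
  have hVX := hasMaj_V_bgPropV (liftBlk blk ι) (blkPair (liftBlk blk ι)) htri hd hrow hσ hρ hρδ hβ hRV hGs hV hsmall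
  have hq1 : 0 ≤ (curvRowLetter ι J p q * (1 + Fintype.card (J ⊕ J))) * (β * (1 - β * (curvRowLetter ι J p q * (1 + Fintype.card (J ⊕ J))) * cr)⁻¹) := by
    have : 0 < 1 - β * (curvRowLetter ι J p q * (1 + Fintype.card (J ⊕ J))) * cr := by linarith
    exact mul_nonneg hRV (mul_nonneg hβ (inv_nonneg.mpr this.le))
  have key := hasMaj_comp_exp htri hd hrow hβ hq1 hρ le_rfl hρδ hG hVX
  refine key.mono fun y y' => le_of_eq ?_
  rw [kappa_ofBlocks, one_mul]

end Letters

end Summit.QuantumFields.YangMills.BalabanUVNodes.N15.CurvedSpecies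

end
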